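import Mathlib
import Summits.ResolutionOfSingularities.ResolutionOfSingularities.Theorems.HomologicalConductorPersistenceConductorFloor
import Literature.RingTheory.CohomologyAnnihilator.RegularRing
import HarnessLib

/-!
# Rung S-2 `PersistenceSurface` (stmt-ResolutionOfSingularities-19970) — the CONDUCTOR FLOOR via FREE KERNELS:
# `𝔠²·ca³(C) ⊆ ca³(B)` for EVERY injective `B → C` with `C` noetherian (no hypothesis on the conductor at all)

Route `ResolutionOfSingularities/HomologicalConductor`, chain W4.4b (cell `res-hironaka`), rung S-2 `PersistenceSurface`
(stmt-ResolutionOfSingularities-19970), registered stub `stub_levelFourPersistenceNonnormalOrNonrational'` (L-other′; Σ8 =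
non-normal stage `0`), cell R5 / S-c.  Seat res-L1-w44b-lead-1 (gen 3).  Supersedes the principal-conductor hypothesis of
`…PersistenceConductorFloor` (p552596) — and its birationality / domain hypotheses — and the projectivity hypothesis
of res-L1-w44b-stub-3's `…PersistenceConductorFloorGeneral` (`W` preserves projectives), by a direct argument that
never leaves the free modules (no coextension `W`).  `[OURS · L1 w44b]`;
folklore module theory; NOT a statement of the manuscript under review (Hironaka 2017); AI-written, weaker than expert review.

## The argument (`stablyAnnihilates_of_ker_presentation`)

`B → C` ANY injective map of commutative rings with `C` noetherian (no domain, birationality or finiteness hypothesis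
is needed for the transfer itself); `c', c'' ∈ B` conductor elements (`c'C, c''C ⊆ B`); `y ∈ ca³(C)`, `b₁ ∈ B` the
element `c''y`.  Let `K` be a second `B`-syzygy, presented as
`K ≅ ker (φ : Bⁿ → Bᵐ)` (`exists_ker_presentation_of_isSyzygy_two`: every second syzygy over any ring is the kernel
of a map between finite FREE modules, after adding a free complement).  Base-change the matrix of `φ` to
`φ_C : Cⁿ → Cᵐ` (`exists_pi_baseChange`); `K_C := ker φ_C` is a second `C`-syzygy (tree `isSyzygy_two_ker`), so
`y • 𝟙_{K_C}` factors `C`-linearly through some `Cʳ` (dimension shifting + dual splitting, as in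
`…PersistenceConductorFloor`).  Then

  `K —(incl)→ K_C —α→ Cʳ —(·c')→ Bʳ —incl→ Cʳ —β→ K_C —(·c'')→ K`

is a `B`-linear factorisation of `(c'·b₁) • 𝟙_K` through the free module `Bʳ`: the entry needs NO conductor factor
(`Bⁿ ⊆ Cⁿ` and `φ_C` extends `φ`), the exit `K_C → K`, `v ↦ c''v ∈ Bⁿ ∩ ker φ_C = ker φ = K`, needs one.  Hence
`StablyAnnihilates B (c'·b₁) K` for every second syzygy, i.e. **`c'·(c''y) ∈ ca³(B)`**
(`mul_mem_cohomologyAnnihilatorOfDegree_three`, CA1), for ALL conductor elements `c', c''`: **`𝔠²·ca³(C) ⊆ ca³(B)`**.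
With the ceiling (p550697) `ca³(B) ⊆ 𝔠`: the centre of every non-normal surface stage is pinched between
`𝔠²·ca³(T̄₀)` and `𝔠`; with `T̄₀` regular, `𝔠² ⊆ ca³(T₀) ⊆ 𝔠` (`conductor_mul_mem_cohomologyAnnihilatorOfDegree_three_of_isRegularRing`).

References (mechanism only): S. B. Iyengar, R. Takahashi, IMRN 2016, Remark 2.13 [`IyengarTakahashi2014`].
-/

-- single-problem summit: the doubled namespace component `ResolutionOfSingularities` is forced
set_option linter.dupNamespace false

noncomputable section

open CategoryTheory Literature.RingTheory.CohomologyAnnihilator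
open Summit.ResolutionOfSingularities.ResolutionOfSingularities.Theorems.NoZeno.SandwichCluster
open Summit.ResolutionOfSingularities.ResolutionOfSingularities.Theorems.HomologicalConductor.PersistenceCyclicTransferSyzygy
  (isSyzygy_two_ker)
open Summit.ResolutionOfSingularities.ResolutionOfSingularities.Theorems.HomologicalConductor.PersistenceConductorCoextension
  (exists_linearMap_conductor)

universe u

namespace Summit.ResolutionOfSingularities.ResolutionOfSingularities.Theorems.HomologicalConductor.PersistenceConductorFloorFree

variable {B C : Type u} [CommRing B] [CommRing C] [Algebra B C]

/-! ## Second syzygies are kernels of maps between finite free modules -/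

omit [Algebra B C] in
/-- **Every second syzygy is the kernel of a map of finite FREE modules**: from `0 → K → P → K' → 0`, `K' ↪ P'`
with `P, P'` finitely generated projective, choose `Bⁿ ↠ P` with a section `s` and `P' ↪ Bᵐ`; then
`K ≅ ker (w ↦ (φ₀(q w) ∈ Bᵐ, w − s(q w) ∈ Bⁿ))`. [folklore] -/
theorem exists_ker_presentation_of_isSyzygy_two {M K : ModuleCat.{u} B} (hK : IsSyzygy 2 M K) :
    ∃ (n m : ℕ) (f : K →ₗ[B] (Fin n → B)) (φ : (Fin n → B) →ₗ[B] (Fin m ⊕ Fin n → B)),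
      Function.Injective f ∧ LinearMap.range f = LinearMap.ker φ := by
  obtain ⟨K', P, h1, hPfin, hPproj, f, g, w, hS⟩ := hK
  obtain ⟨K'', P', -, hP'fin, hP'proj, f', g', w', hS'⟩ := h1
  haveI := hPfin
  haveI := hP'fin
  haveI : Module.Projective B P := (IsProjective.iff_projective (R := B) P).mpr hPproj
  haveI : Module.Projective B P' := (IsProjective.iff_projective (R := B) P').mpr hP'proj
  have hf : Function.Injective f.hom := (ModuleCat.mono_iff_injective f).mp hS.mono_f
  have hf' : Function.Injective f'.hom := (ModuleCat.mono_iff_injective f').mp hS'.mono_f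
  let φ₀ : P →ₗ[B] P' := f'.hom ∘ₗ g.hom
  have hfφ₀ : LinearMap.range f.hom = LinearMap.ker φ₀ := by
    rw [LinearMap.ker_comp_of_ker_eq_bot _ (LinearMap.ker_eq_bot.mpr hf')]
    exact hS.exact.moduleCat_range_eq_ker
  -- `Bⁿ ↠ P` with a section, `P' ↪ Bᵐ`
  obtain ⟨n, q, hq⟩ := Module.Finite.exists_fin' B P
  obtain ⟨s, hs⟩ := Module.projective_lifting_property q (LinearMap.id : P →ₗ[B] P) hq
  obtain ⟨m, q', hq'⟩ := Module.Finite.exists_fin' B P'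
  obtain ⟨s', hs'⟩ := Module.projective_lifting_property q' (LinearMap.id : P' →ₗ[B] P') hq'
  have hqs : ∀ p, q (s p) = p := fun p => by
    rw [← LinearMap.comp_apply, hs, LinearMap.id_apply]
  have hs'inj : Function.Injective s' := fun x y hxy => by
    have := congrArg q' hxy
    rwa [← LinearMap.comp_apply, ← LinearMap.comp_apply, hs', LinearMap.id_apply, LinearMap.id_apply] at this
  let Φ : (Fin n → B) →ₗ[B] (Fin m → B) × (Fin n → B) :=
    LinearMap.prod (s' ∘ₗ φ₀ ∘ₗ q) (LinearMap.id - s ∘ₗ q)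
  let e : ((Fin m → B) × (Fin n → B)) ≃ₗ[B] (Fin m ⊕ Fin n → B) :=
    (LinearEquiv.sumArrowLequivProdArrow (Fin m) (Fin n) B B).symm
  refine ⟨n, m, s ∘ₗ f.hom, e.toLinearMap ∘ₗ Φ, ?_, ?_⟩
  · exact (LinearMap.ker_eq_bot.mp (by
      rw [LinearMap.ker_eq_bot]
      intro x y hxy
      have := congrArg q hxy
      simp only [LinearMap.coe_comp, Function.comp_apply, hqs] at this
      exact hf this))
  · apply le_antisymm
    · rintro _ ⟨k, rfl⟩
      rw [LinearMap.mem_ker]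
      have hk : φ₀ (f.hom k) = 0 := LinearMap.mem_ker.mp (hfφ₀ ▸ LinearMap.mem_range_self _ k)
      have h1 : Φ (s (f.hom k)) = 0 := by
        refine Prod.ext ?_ ?_
        · change s' (φ₀ (q (s (f.hom k)))) = 0
          rw [hqs, hk, map_zero]
        · change s (f.hom k) - s (q (s (f.hom k))) = 0
          rw [hqs, sub_self]
      change e (Φ (s (f.hom k))) = 0
      rw [h1, map_zero]
    · intro w hw
      rw [LinearMap.mem_ker, LinearMap.comp_apply, LinearEquiv.coe_coe, LinearEquiv.map_eq_zero_iff] at hw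
      have hw1 : s' (φ₀ (q w)) = 0 := (Prod.mk_eq_zero.mp hw).1
      have hw2 : w - s (q w) = 0 := (Prod.mk_eq_zero.mp hw).2
      have hqw : q w ∈ LinearMap.ker φ₀ := by
        rw [LinearMap.mem_ker]
        exact hs'inj (by rw [hw1, map_zero])
      rw [← hfφ₀] at hqw
      obtain ⟨k, hk⟩ := hqw
      refine ⟨k, ?_⟩
      rw [LinearMap.comp_apply, hk]
      exact (sub_eq_zero.mp hw2).symm

/-! ## Base change of a map of finite free modules along `B → C` -/

/-- **Base change of `φ : B^ι → B^κ` to `φ_C : C^ι → C^κ`** (map the matrix of `φ`): `φ_C (w) = φ(w)` on vectors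
with entries in `B`. [folklore] -/
theorem exists_pi_baseChange {ι κ : Type} [Fintype ι] [DecidableEq ι] [Fintype κ]
    (φ : (ι → B) →ₗ[B] (κ → B)) :
    ∃ φC : (ι → C) →ₗ[C] (κ → C),
      ∀ w : ι → B, φC (fun i => algebraMap B C (w i)) = fun j => algebraMap B C (φ w j) := by
  refine ⟨Matrix.mulVecLin ((LinearMap.toMatrix' φ).map (algebraMap B C)), fun w => ?_⟩
  ext j
  rw [Matrix.mulVecLin_apply]
  have h := RingHom.map_mulVec (algebraMap B C) (LinearMap.toMatrix' φ) w j
  rw [LinearMap.toMatrix'_mulVec] at h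
  change Matrix.mulVec ((LinearMap.toMatrix' φ).map (algebraMap B C)) ((algebraMap B C) ∘ w) j = _
  exact h.symm

/-! ## The floor, from a kernel presentation -/

/-- **The transfer on a kernel presentation** (see the module docstring): `B → C` injective with `C` noetherian,
`c', c''` conductor elements, `y ∈ ca³(C)`, `b₁ = c''y ∈ B`; if `K ↪ B^ι` with image `ker φ` for a `B`-linear
`φ : B^ι → B^κ`, then `(c'·b₁) • 𝟙_K` factors `B`-linearly through a finite free `B`-module.
[cite: IyengarTakahashi2014, Remark 2.13] -/
theorem stablyAnnihilates_of_ker_presentation [IsNoetherianRing C]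
    (hinj : Function.Injective (algebraMap B C)) {c' c'' : B} (hc' : ∀ γ : C, ∃ b : B, algebraMap B C b = algebraMap B C c' * γ)
    (hc'' : ∀ γ : C, ∃ b : B, algebraMap B C b = algebraMap B C c'' * γ)
    {y : C} (hy : y ∈ cohomologyAnnihilatorOfDegree C 3) {b₁ : B}
    (hb₁ : algebraMap B C b₁ = algebraMap B C c'' * y)
    (K : ModuleCat.{u} B) {ι κ : Type} [Fintype ι] [DecidableEq ι] [Fintype κ]
    (f : K →ₗ[B] (ι → B)) (hf : Function.Injective f) (φ : (ι → B) →ₗ[B] (κ → B))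
    (hfφ : LinearMap.range f = LinearMap.ker φ) :
    StablyAnnihilates B (c' * b₁) K := by
  classical
  -- base change and the second `C`-syzygy `K_C = ker φ_C`
  obtain ⟨φC, hφC⟩ := exists_pi_baseChange (C := C) φ
  have h2 : IsSyzygy 2 (ModuleCat.of C ((κ → C) ⧸ LinearMap.range φC)) (ModuleCat.of C (LinearMap.ker φC)) :=
    isSyzygy_two_ker φC
  haveI : Module.Finite C (LinearMap.ker φC) := Module.IsNoetherian.finite C _
  -- `y • 𝟙_{K_C}` factors `C`-linearly through a finite free module
  obtain ⟨r, qC, hqC⟩ := Module.Finite.exists_fin' C (LinearMap.ker φC)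
  have hS := LinearMap.shortExact_shortComplexKer hqC
  haveI : Module.Finite C (LinearMap.ker qC) := Module.IsNoetherian.finite C _
  have hcls : y • hS.extClass = 0 :=
    ext_smul_eq_zero_of_isSyzygy 2 h2 (ModuleCat.of C (LinearMap.ker qC)) 1 le_rfl y
      (fun e' => smul_eq_zero_of_mem_cohomologyAnnihilatorOfDegree hy (by omega) e') _
  obtain ⟨ψ, hψ⟩ := exists_comp_eq_smul_id_X₃_of_smul_extClass_eq_zero hS hcls
  have hψq : ∀ θ : LinearMap.ker φC, qC (ψ.hom θ) = y • θ := fun θ => by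
    have := congrArg (fun χ => χ.hom θ) hψ
    simpa using this
  -- inclusions `B^ι → C^ι`, `B^κ → C^κ` and conductor multiplications
  let ιn : (ι → B) →ₗ[B] (ι → C) :=
    { toFun := fun w i => algebraMap B C (w i)
      map_add' := fun w w' => by ext i; simp
      map_smul' := fun r w => by ext i; simp [Algebra.smul_def] }
  have ιn_apply : ∀ w i, ιn w i = algebraMap B C (w i) := fun _ _ => rfl
  have ιn_inj : Function.Injective ιn := fun w w' h => by
    ext i
    exact hinj (by rw [← ιn_apply, ← ιn_apply, h])
  obtain ⟨μ', hμ'⟩ := exists_linearMap_conductor hinj hc'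
  obtain ⟨μ'', hμ''⟩ := exists_linearMap_conductor hinj hc''
  let toB : (Fin r → C) →ₗ[B] (Fin r → B) :=
    { toFun := fun v i => μ' (v i)
      map_add' := fun v v' => by ext i; simp
      map_smul' := fun s v => by ext i; simp }
  let toC : (Fin r → B) →ₗ[B] (Fin r → C) :=
    { toFun := fun w i => algebraMap B C (w i)
      map_add' := fun w w' => by ext i; simp
      map_smul' := fun s w => by ext i; simp [Algebra.smul_def] }
  have htoC : ∀ v : Fin r → C, toC (toB v) = algebraMap B C c' • v := by
    intro v; ext i
    change algebraMap B C (μ' (v i)) = algebraMap B C c' * v i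
    exact hμ' (v i)
  let μn : (ι → C) →ₗ[B] (ι → B) :=
    { toFun := fun v i => μ'' (v i)
      map_add' := fun v v' => by ext i; simp
      map_smul' := fun s v => by ext i; simp }
  have hμn : ∀ v : ι → C, ιn (μn v) = algebraMap B C c'' • v := by
    intro v; ext i
    change algebraMap B C (μ'' (v i)) = algebraMap B C c'' * v i
    exact hμ'' (v i)
  -- `φ_C ∘ ιn = ιm ∘ φ` and the kernel bookkeeping
  have hφCι : ∀ w : ι → B, φC (ιn w) = fun j => algebraMap B C (φ w j) := fun w => hφC w
  have hfker : ∀ k : K, φ (f k) = 0 := fun k =>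
    LinearMap.mem_ker.mp (hfφ ▸ LinearMap.mem_range_self f k)
  -- entry `K → K_C` (no conductor factor)
  let entry : K →ₗ[B] LinearMap.ker φC :=
    { toFun := fun k => ⟨ιn (f k), by
        rw [LinearMap.mem_ker, hφCι, hfker]
        ext j
        exact map_zero _⟩
      map_add' := fun k k' => by
        apply Subtype.ext
        change ιn (f (k + k')) = ιn (f k) + ιn (f k')
        rw [map_add, map_add]
      map_smul' := fun s k => by
        apply Subtype.ext
        change ιn (f (s • k)) = s • ιn (f k)
        rw [map_smul, map_smul] }
  have entry_val : ∀ k, (entry k : ι → C) = ιn (f k) := fun _ => rfl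
  -- exit `K_C → K`, `v ↦ f⁻¹ (c'' v)`
  have hexit_mem : ∀ v : LinearMap.ker φC, μn (v : ι → C) ∈ LinearMap.range f := by
    intro v
    rw [hfφ, LinearMap.mem_ker]
    have h1 : φC (ιn (μn (v : ι → C))) = 0 := by
      rw [hμn, map_smul, LinearMap.mem_ker.mp v.2, smul_zero]
    rw [hφCι] at h1
    ext j
    apply hinj
    have := congr_fun h1 j
    simp only [Pi.zero_apply] at this
    rw [Pi.zero_apply, map_zero]
    exact this
  let exit : LinearMap.ker φC →ₗ[B] K :=
    (LinearEquiv.ofInjective f hf).symm.toLinearMap ∘ₗ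
      (LinearMap.codRestrict (LinearMap.range f) (μn ∘ₗ (LinearMap.ker φC).subtype.restrictScalars B) hexit_mem)
  have hexit : ∀ v : LinearMap.ker φC, f (exit v) = μn (v : ι → C) := fun v =>
    LinearEquiv.ofInjective_symm_apply (h := hf) f ⟨μn (v : ι → C), hexit_mem v⟩
  -- the free factorisation
  refine ⟨ModuleCat.of B (Fin r → B), inferInstance,
    (IsProjective.iff_projective (R := B) (Fin r → B)).mp inferInstance,
    ModuleCat.ofHom (toB ∘ₗ (ψ.hom.restrictScalars B) ∘ₗ entry),
    ModuleCat.ofHom (exit ∘ₗ (qC.restrictScalars B) ∘ₗ toC), ?_⟩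
  ext k
  change exit (qC (toC (toB (ψ.hom (entry k))))) = (c' * b₁) • k
  apply hf
  rw [hexit, htoC, map_smul, hψq, smul_smul, map_smul]
  apply ιn_inj
  rw [hμn, Submodule.coe_smul, entry_val, smul_smul, map_smul, ← algebraMap_smul C (c' * b₁), map_mul, hb₁]
  congr 1
  ring

/-- **THE GENERAL CONDUCTOR FLOOR `𝔠²·ca³(C) ⊆ ca³(B)`.**  `B → C` injective, `B` and `C` noetherian; for conductor
elements `c', c''` and `y ∈ ca³(C)`, the element `c'·b₁` (`b₁ = c''y` in `C`) lies in `ca³(B)` — NO hypothesis on the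
shape of the conductor, on birationality or on finiteness (CA1 + `exists_ker_presentation_of_isSyzygy_two` +
`stablyAnnihilates_of_ker_presentation`). [cite: IyengarTakahashi2014, Remark 2.13] -/
theorem mul_mem_cohomologyAnnihilatorOfDegree_three [IsNoetherianRing B] [IsNoetherianRing C]
    (hinj : Function.Injective (algebraMap B C)) {c' c'' : B} (hc' : ∀ γ : C, ∃ b : B, algebraMap B C b = algebraMap B C c' * γ)
    (hc'' : ∀ γ : C, ∃ b : B, algebraMap B C b = algebraMap B C c'' * γ)
    {y : C} (hy : y ∈ cohomologyAnnihilatorOfDegree C 3) {b₁ : B}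
    (hb₁ : algebraMap B C b₁ = algebraMap B C c'' * y) :
    c' * b₁ ∈ cohomologyAnnihilatorOfDegree B 3 := by
  refine (mem_cohomologyAnnihilatorOfDegree_succ_iff_forall_isSyzygy (n := 2) (c' * b₁)).mpr
    fun M K hM hK => ?_
  obtain ⟨n, m, f, φ, hf, hfφ⟩ := exists_ker_presentation_of_isSyzygy_two hK
  exact stablyAnnihilates_of_ker_presentation hinj hc' hc'' hy hb₁ K f hf φ hfφ

/-- **Regular normalisation: `𝔠² ⊆ ca³(B)`** with no hypothesis on the conductor — `C` regular of dimension `≤ 2`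
gives `1 ∈ ca³(C)`; take `y = 1`. The two-dimensional analogue of the curve floor `𝔠 ⊆ ca²`. [OURS] -/
theorem conductor_mul_mem_cohomologyAnnihilatorOfDegree_three_of_isRegularRing [IsNoetherianRing B]
    [IsRegularRing C] (hdim : ringKrullDim C ≤ (2 : ℕ)) (hinj : Function.Injective (algebraMap B C))
    {c' c'' : B} (hc' : ∀ γ : C, ∃ b : B, algebraMap B C b = algebraMap B C c' * γ)
    (hc'' : ∀ γ : C, ∃ b : B, algebraMap B C b = algebraMap B C c'' * γ) :
    c' * c'' ∈ cohomologyAnnihilatorOfDegree B 3 := by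
  have h1 : (1 : C) ∈ cohomologyAnnihilatorOfDegree C 3 := by
    rw [cohomologyAnnihilatorOfDegree_eq_top_of_isRegularRing (A := C) (n := 2) hdim]
    exact Submodule.mem_top
  exact mul_mem_cohomologyAnnihilatorOfDegree_three hinj hc' hc'' h1 (b₁ := c'') (by rw [mul_one])

end Summit.ResolutionOfSingularities.ResolutionOfSingularities.Theorems.HomologicalConductor.PersistenceConductorFloorFree

end
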